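import Mathlib
import Summits.ValiantsHypothesis.ValiantsHypothesis.Theorems.FifoMatchingNNDivisionHardFewGeneratorsTransport
import HarnessLib

/-!
# ★★★ `NNDivisionHard` ON THE COFACTORS WHOSE NEWTON POLYTOPE HAS AT MOST `2^{κ√n}` GENERATORS (in particular: at most `2^{κ√n}`
# MONOMIALS), ANY DEGREE — PROP A (the chamber certificate) at the route rate and at exponential rate, in the crux's own currency
# (crux `Theses.FifoMatching.NNDivisionHard`, stmt-ValiantsHypothesis-21181; high-degree regime)

Sequel of ✓ `…NNDivisionHardFewGeneratorsTransport` (the K1/AFHMS transport WITH the passenger's number of generators,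
`FewGenerators.transport_geometric_card`, `nn_passenger_three_pow_le_card`).  The rate bookkeeping of ✓ `…NNDivisionHardLowDimRate`
(`growth_eventually`, `T_pow_four_le`) is run on the generator count instead of the dimension:

* `three_pow_half_le`, `card_side_condition` — `3^h ≤ m (r+1) 2^h`, `m ≤ 2^x`, `4x ≤ h` give `3^{⌊h/2⌋} ≤ (r+1) 2^{⌊h/2⌋}`.
* ★★ `corMinkowskiHard_fewGenerators` — COR level: for every `c`, eventually in `h`, every passenger family `q : J → ℝ^{h×h}` with
  `|J| · 2^{⌈h/2⌉} ≤ 3^{⌈h/2⌉}` (at most `1.5^{⌈h/2⌉}` generators) has `xc(COR(K_h) + conv q) > 2^((log₂ h + c)^c)`.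
* ★★★ `nnDivisionHard_fewGeneratorsExp` / `nnDivisionHard_fewMonomialsExp` — THE CRUX RESTRICTED TO COFACTORS `hh ≠ 0` WHOSE NEWTON
  POLYTOPE IS THE HULL OF AT MOST `2^{κ√n}` POINTS (e.g. its vertices; in particular `|supp hh| ≤ 2^{κ√n}`), PROVED unconditionally:
  `∃ κ > 0, ∀ c`, eventually in `n`, `2^((log₂ n + c)^c) < L₊(NN_n · hh) + L₊(hh)`.  NO condition on the degrees of `hh` (powers,
  power towers, products of `2^{o(√n)}`-nomials of ANY degree are decided: the HIGH-DEGREE regime of record), none on its Newton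
  dimension, `hh(0)` or signs.  Upgrades the tree's few-monomial tier `|supp hh|² ≤ n`
  (✓ `…NNDivisionHardNewtonDimension.fewMonomials_not_certificate_qp`) to `2^{κ√n}` generators; incomparable with the low-dimension
  tier (✓ `…NNDivisionHardLowDimRate.nnDivisionHard_lowdim`); contains the binomial-power / power-sum tiers at exponential count.
* ★★★ `nn_complexity_expLowerBound_fewGenerators` / `…_fewMonomials` — EXPONENTIAL RATE: `∃ κ > 0`, eventually in `n`, every such
  `hh` has `2^{κ√n} ≤ L₊(NN_n · hh)` (the currency of the sibling crux `NNNotVP`'s stub B2 ≡ exponential division hardness).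

HONEST FRAMING: a restriction theorem in the crux's literal currency (a decided sub-class of cofactors), NOT the crux: stmt-21181
`NNDivisionHard` (all cofactors) is OPEN — the survivors are cheap cofactors whose Newton polytopes need MORE than `2^{κ√n}`
generators (fan-saturating passengers); COR-MINKOWSKI / COR-VIRTUAL OPEN; `NNNotVP` OPEN; `VP ≠ VNP` NOT proved; nothing here is
a summit statement.  References: Hrubeš–Yehudayoff 2021 §6 Problem 2 [HrubesYehudayoff2021]; Fiorini et al. 2015 Thm 7
[FioriniEtAl2015]; Kaibel–Weltge 2015 Thm 1 [KaibelWeltge2014]; AFHMS 2019 [AboulkerEtAl2019 = arXiv:1806.00541].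
-/

set_option autoImplicit false

-- the mandated summit-side namespace repeats a component by design (single-problem summit)
set_option linter.dupNamespace false

noncomputable section

open Matrix Finset
open scoped Pointwise

namespace Summit.ValiantsHypothesis.ValiantsHypothesis.Theorems.FifoMatching

namespace FewGenerators

open Literature.Barriers.PneNP (HasEFOfSize)
open Literature.Combinatorics.Optimization (corPolytopeGraph)
open Summit.ValiantsHypothesis.ValiantsHypothesis.Theorems.FifoMatching.XcDivision

/-! ## §2 AT THE ROUTE RATE (§1 = the transport, in `…NNDivisionHardFewGeneratorsTransport`) -/

section RouteRate

open MvPolynomial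
open scoped NNReal
open Literature.Computability.AlgebraicComplexity (complexity nestFreeMatchingPoly)
open Literature.Computability.AlgebraicComplexity.MonotoneCircuitEF (hasEFOfSize_newtonPolytope_complexity)
open Literature.Algebra.Polynomial.NewtonPolytope (newtonPolytope newtonPolytope_mul)
open Summit.ValiantsHypothesis.ValiantsHypothesis.Theorems.FifoMatching.QueueGridFace
  (realOf suppPts newt growth_eventually)
open Summit.ValiantsHypothesis.ValiantsHypothesis.Theorems.FifoMatching.MonomialCofactor (newt_eq_newtonPolytope)

/-- from the chamber certificate `3^h ≤ m (r+1) 2^h` and few generators `m · 2^{h − ⌊h/2⌋} ≤ 3^{h − ⌊h/2⌋}`, the half-level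
bound `3^{⌊h/2⌋} ≤ (r+1) · 2^{⌊h/2⌋}`. [folklore] -/
theorem three_pow_half_le {h m r : ℕ} (hA : 3 ^ h ≤ m * (r + 1) * 2 ^ h)
    (hm : m * 2 ^ (h - h / 2) ≤ 3 ^ (h - h / 2)) : 3 ^ (h / 2) ≤ (r + 1) * 2 ^ (h / 2) := by
  by_contra hlt
  push Not at hlt
  have hsplit2 : 2 ^ (h - h / 2) * 2 ^ (h / 2) = 2 ^ h := by
    rw [← pow_add, Nat.sub_add_cancel (Nat.div_le_self h 2)]
  have hsplit3 : 3 ^ (h - h / 2) * 3 ^ (h / 2) = 3 ^ h := by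
    rw [← pow_add, Nat.sub_add_cancel (Nat.div_le_self h 2)]
  have key : m * (r + 1) * 2 ^ h < 3 ^ h := by
    calc m * (r + 1) * 2 ^ h = (m * 2 ^ (h - h / 2)) * ((r + 1) * 2 ^ (h / 2)) := by
          rw [← hsplit2]; ring
      _ ≤ 3 ^ (h - h / 2) * ((r + 1) * 2 ^ (h / 2)) := Nat.mul_le_mul_right _ hm
      _ < 3 ^ (h - h / 2) * 3 ^ (h / 2) := Nat.mul_lt_mul_of_pos_left hlt (by positivity)
      _ = 3 ^ h := hsplit3
  omega

/-- ★★ **COR level, passengers with at most `1.5^{⌈h/2⌉}` generators (PROVED):** for every `c`, eventually in `h`, every family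
`q : J → ℝ^{h×h}` with `|J| · 2^{h−⌊h/2⌋} ≤ 3^{h−⌊h/2⌋}` gives `xc(COR(K_h) + conv q) > 2^((log₂ h + c)^c)`. [cite: KaibelWeltge2014, Thm. 1] -/
theorem corMinkowskiHard_fewGenerators (c : ℕ) : ∃ h₀ : ℕ, ∀ h ≥ h₀, ∀ {J : Type} [Fintype J] [Nonempty J]
    (q : J → (Fin h × Fin h → ℝ)) (r : ℕ), Fintype.card J * 2 ^ (h - h / 2) ≤ 3 ^ (h - h / 2) →
      HasEFOfSize (corPolytopeGraph (⊤ : SimpleGraph (Fin h)) + convexHull ℝ (Set.range q)) r →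
        2 ^ ((Nat.log 2 h + c) ^ c) < r := by
  obtain ⟨r₀, hr₀2, hgrowth⟩ := growth_eventually c (c := (1 / 2 : ℝ)) (by norm_num)
  refine ⟨r₀, fun h hh J _ _ q r hgen hEF => ?_⟩
  classical
  obtain ⟨K, q', hq', hK⟩ := exists_fin_range_eq_card q
  rw [← hq'] at hEF
  have hA := corPolytopeGraph_top_add_hull_three_pow_le q' (Nat.succ_pos K) hEF
  rw [hK] at hA
  have hk : 3 ^ (h / 2) ≤ (r + 1) * 2 ^ (h / 2) := three_pow_half_le hA hgen
  have hkR : (3 : ℝ) ^ (h / 2) ≤ ((r : ℝ) + 1) * 2 ^ (h / 2) := by exact_mod_cast hk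
  have h32 : ((3 : ℝ) / 2) ^ (h / 2) ≤ (r : ℝ) + 1 := by
    rw [div_pow, div_le_iff₀ (by positivity)]
    exact hkR
  have hsqrt : (2 : ℝ) ^ ((1 / 2 : ℝ) * ((h / 2 : ℕ) : ℝ)) ≤ ((3 : ℝ) / 2) ^ (h / 2) := by
    rw [Real.rpow_mul (by norm_num), Real.rpow_natCast]
    refine pow_le_pow_left₀ (by positivity) ?_ _
    rw [← Real.sqrt_eq_rpow]
    calc Real.sqrt 2 ≤ Real.sqrt (((3 : ℝ) / 2) ^ 2) := Real.sqrt_le_sqrt (by norm_num)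
      _ = 3 / 2 := Real.sqrt_sq (by norm_num)
  have hg := hgrowth h hh
  have hT : (((2 ^ ((Nat.log 2 h + c) ^ c) : ℕ) : ℕ) : ℝ) = (2 : ℝ) ^ ((Nat.log 2 h + c) ^ c) := by
    push_cast; ring
  have h4 : (1 : ℝ) ≤ (h : ℝ) ^ 4 := one_le_pow₀ (by exact_mod_cast (show 1 ≤ h by omega))
  have : (((2 ^ ((Nat.log 2 h + c) ^ c) : ℕ) : ℕ) : ℝ) < r := by
    rw [hT]
    by_contra hcon
    push Not at hcon
    linarith
  exact_mod_cast this

/-- `m ≤ 2^x` generators fit under `1.5^{⌈h/2⌉}` once `4x ≤ h`. [folklore] -/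
theorem card_side_condition {m h : ℕ} {x : ℝ} (hm : (m : ℝ) ≤ (2 : ℝ) ^ x) (hxh : 4 * x ≤ h) :
    m * 2 ^ (h - h / 2) ≤ 3 ^ (h - h / 2) := by
  set t : ℕ := h - h / 2 with ht
  have hth : (h : ℝ) ≤ 2 * (t : ℝ) := by
    have : h ≤ 2 * t := by omega
    exact_mod_cast this
  have hxt : x ≤ (1 / 2 : ℝ) * (t : ℝ) := by linarith
  have h1 : (2 : ℝ) ^ x ≤ (2 : ℝ) ^ ((1 / 2 : ℝ) * (t : ℝ)) :=
    Real.rpow_le_rpow_of_exponent_le (by norm_num) hxt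
  have h2 : (2 : ℝ) ^ ((1 / 2 : ℝ) * (t : ℝ)) ≤ ((3 : ℝ) / 2) ^ t := by
    rw [Real.rpow_mul (by norm_num), Real.rpow_natCast]
    refine pow_le_pow_left₀ (by positivity) ?_ _
    rw [← Real.sqrt_eq_rpow]
    calc Real.sqrt 2 ≤ Real.sqrt (((3 : ℝ) / 2) ^ 2) := Real.sqrt_le_sqrt (by norm_num)
      _ = 3 / 2 := Real.sqrt_sq (by norm_num)
  have h3 : (m : ℝ) * 2 ^ t ≤ ((3 : ℝ) / 2) ^ t * 2 ^ t :=
    mul_le_mul_of_nonneg_right (hm.trans (h1.trans h2)) (by positivity)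
  have h4 : ((3 : ℝ) / 2) ^ t * 2 ^ t = 3 ^ t := by
    rw [← mul_pow]; norm_num
  rw [h4] at h3
  exact_mod_cast h3

/-- ★★★ **`NNDivisionHard` ON THE COFACTORS WHOSE NEWTON POLYTOPE HAS AT MOST `2^{κ√n}` GENERATORS (PROVED, unconditional):**
`∃ κ > 0, ∀ c`, eventually in `n`, every `hh ≠ 0` over `ℝ≥0` whose Newton polytope is the hull of a family `q₀ : J → ℝ^{2n×2n}` of at
most `2^{κ·√n}` points (e.g. its VERTICES) satisfies `2^((log₂ n + c)^c) < L₊(NN_n · hh) + L₊(hh)`.  No condition on the degrees of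
`hh`, its number of monomials, Newton dimension, `hh(0)` or signs. [cite: HrubesYehudayoff2021, §6 Problem 2] [cite: KaibelWeltge2014, Thm. 1] -/
theorem nnDivisionHard_fewGeneratorsExp : ∃ κ : ℝ, 0 < κ ∧ ∀ c : ℕ, ∃ n₀ : ℕ, ∀ n ≥ n₀,
    ∀ hh : MvPolynomial (Fin (2 * n) × Fin (2 * n)) ℝ≥0, hh ≠ 0 →
      ∀ {J : Type} [Fintype J] [Nonempty J] (q₀ : J → (Fin (2 * n) × Fin (2 * n)) → ℝ),
        newtonPolytope (MvPolynomial.map NNReal.toRealHom hh) = convexHull ℝ (Set.range q₀) →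
        (Fintype.card J : ℝ) ≤ (2 : ℝ) ^ (κ * Real.sqrt n) →
          2 ^ ((Nat.log 2 n + c) ^ c) < complexity (nestFreeMatchingPoly n ℝ≥0 * hh) + complexity hh := by
  obtain ⟨cA, hcA, t₀, htrans⟩ := transport_geometric_card
  set cm : ℝ := min cA 1 with hcm
  have hcm0 : 0 < cm := lt_min hcA one_pos
  have hcmA : cm ≤ cA := min_le_left _ _
  have hcm1 : cm ≤ 1 := min_le_right _ _
  refine ⟨cm / 64, by positivity, fun c => ?_⟩
  obtain ⟨h₀, hh₀⟩ := corMinkowskiHard_fewGenerators (4 ^ (c + 1) + c + 1)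
  obtain ⟨S₁, hS₁⟩ := exists_nat_ge ((20 / cm) ^ 2)
  obtain ⟨S₀, hS₀a, hS₀b, hS₀c, hS₀d⟩ :
      ∃ S₀ : ℕ, 4 * t₀ + 4 ≤ S₀ ∧ h₀ ^ 2 ≤ S₀ ∧ S₁ ≤ S₀ ∧ 16 ≤ S₀ :=
    ⟨4 * t₀ + 4 + h₀ ^ 2 + S₁ + 16, by omega, by omega, by omega, by omega⟩
  refine ⟨S₀ ^ 2, fun n hn hh hh0 J _ _ q₀ hQ hcard => ?_⟩
  classical
  by_contra hle
  push Not at hle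
  have hEF : HasEFOfSize (newt (nestFreeMatchingPoly n ℝ≥0) + convexHull ℝ (Set.range q₀))
      (3 * 2 ^ ((Nat.log 2 n + c) ^ c)) := by
    have h1 := hasEFOfSize_newtonPolytope_complexity (nestFreeMatchingPoly n ℝ≥0 * hh)
    rw [map_mul, newtonPolytope_mul, hQ, ← newt_eq_newtonPolytope] at h1
    exact h1.of_le (by omega)
  obtain ⟨s, hs⟩ : ∃ s, s = Nat.sqrt n := ⟨_, rfl⟩
  have hsS : S₀ ≤ s := by rw [hs]; exact Nat.le_sqrt'.2 hn
  have hss : s ^ 2 ≤ n := by rw [hs]; exact Nat.sqrt_le' n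
  have hns : n < (s + 1) ^ 2 := by rw [hs]; exact Nat.lt_succ_sqrt' n
  obtain ⟨g, hg⟩ : ∃ g, g = s / 4 := ⟨_, rfl⟩
  have h4g : 4 * g ≤ s := by rw [hg]; exact Nat.mul_div_le s 4
  have hg4 : s < 4 * (g + 1) := by rw [hg]; omega
  have hg1 : 1 ≤ g := by omega
  have hgt : t₀ ≤ g := by omega
  have hn' : (2 * g + 1) * (2 * (2 * g) + 1) ≤ n := by nlinarith [Nat.mul_le_mul h4g h4g]
  obtain ⟨h, hch, K, q, hEF', hKq⟩ :=
    htrans n (2 * g) g (by omega) hn' (le_refl _) hgt q₀ (3 * 2 ^ ((Nat.log 2 n + c) ^ c)) hEF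
  have hsqrt_s : Real.sqrt s * Real.sqrt s = s := Real.mul_self_sqrt (Nat.cast_nonneg s)
  have hg_real : (s : ℝ) / 4 - 1 ≤ g := by
    have : (s : ℝ) < 4 * ((g : ℝ) + 1) := by exact_mod_cast hg4
    linarith
  have h1 : cm * ((s : ℝ) / 4 - 1) ≤ h :=
    calc cm * ((s : ℝ) / 4 - 1) ≤ cm * g := mul_le_mul_of_nonneg_left hg_real hcm0.le
      _ ≤ cA * g := mul_le_mul_of_nonneg_right hcmA (Nat.cast_nonneg g)
      _ ≤ h := hch
  have hreal : Real.sqrt s + 1 ≤ (h : ℝ) := by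
    have hS₁s : ((20 / cm) ^ 2 : ℝ) ≤ s := le_trans hS₁ (by exact_mod_cast (show S₁ ≤ s by omega))
    have hsq : 20 / cm ≤ Real.sqrt s := by
      rw [show (20 / cm : ℝ) = Real.sqrt ((20 / cm) ^ 2) by rw [Real.sqrt_sq (by positivity)]]
      exact Real.sqrt_le_sqrt hS₁s
    have h20 : 20 ≤ cm * Real.sqrt s := by
      have := mul_le_mul_of_nonneg_left hsq hcm0.le
      rwa [show cm * (20 / cm) = 20 by field_simp] at this
    have h2 : 20 * Real.sqrt s ≤ cm * s := by
      have := mul_le_mul_of_nonneg_right h20 (Real.sqrt_nonneg s)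
      rw [mul_assoc, hsqrt_s] at this
      exact this
    have hs1 : 1 ≤ Real.sqrt s := by
      rw [show (1 : ℝ) = Real.sqrt 1 by simp]
      exact Real.sqrt_le_sqrt (by exact_mod_cast (show 1 ≤ s by omega))
    nlinarith
  have hh₀' : h₀ ≤ h := by
    have : (h₀ : ℝ) ≤ Real.sqrt s := by
      rw [show (h₀ : ℝ) = Real.sqrt ((h₀ : ℝ) ^ 2) by rw [Real.sqrt_sq (Nat.cast_nonneg _)]]
      exact Real.sqrt_le_sqrt (by exact_mod_cast (show h₀ ^ 2 ≤ s by omega))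
    exact_mod_cast (by linarith : (h₀ : ℝ) ≤ h)
  have hn4 : n < h ^ 4 := by
    have hs1 : s + 1 ≤ h ^ 2 := by
      have : (s : ℝ) + 1 ≤ (h : ℝ) ^ 2 := by nlinarith [Real.sqrt_nonneg s]
      exact_mod_cast this
    calc n < (s + 1) ^ 2 := hns
      _ ≤ (h ^ 2) ^ 2 := Nat.pow_le_pow_left hs1 2
      _ = h ^ 4 := by rw [← pow_mul]
  have hn0 : n ≠ 0 := by
    have : 16 ^ 2 ≤ s ^ 2 := Nat.pow_le_pow_left (by omega) 2
    omega
  have hgen : Fintype.card (Fin (K + 1)) * 2 ^ (h - h / 2) ≤ 3 ^ (h - h / 2) := by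
    have hsqn : Real.sqrt n ≤ (s : ℝ) + 1 := by
      calc Real.sqrt n ≤ Real.sqrt (((s : ℝ) + 1) ^ 2) :=
            Real.sqrt_le_sqrt (by exact_mod_cast hns.le)
        _ = (s : ℝ) + 1 := Real.sqrt_sq (by positivity)
    have hs16 : (16 : ℝ) ≤ s := by exact_mod_cast (show 16 ≤ s by omega)
    have hx4 : 4 * (cm / 64 * Real.sqrt n) ≤ h := by
      have e1 : cm / 64 * Real.sqrt n ≤ cm / 64 * ((s : ℝ) + 1) :=
        mul_le_mul_of_nonneg_left hsqn (by positivity)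
      nlinarith
    have hKcard : ((Fintype.card (Fin (K + 1)) : ℕ) : ℝ) ≤ (2 : ℝ) ^ (cm / 64 * Real.sqrt n) := by
      have : Fintype.card (Fin (K + 1)) ≤ Fintype.card J := by
        rw [Fintype.card_fin]; exact hKq
      exact le_trans (by exact_mod_cast this) hcard
    exact card_side_condition hKcard hx4
  have hT := T_pow_four_le (c := c) hn0 hn4
  have hlt := hh₀ h hh₀' q (3 * 2 ^ ((Nat.log 2 n + c) ^ c)) hgen hEF'
  have hT2 : 2 ≤ 2 ^ ((Nat.log 2 n + c) ^ c) := by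
    show 2 ^ 1 ≤ 2 ^ _
    exact Nat.pow_le_pow_right (by norm_num)
      (Nat.one_le_pow _ _ (by
        have h256 : 16 ^ 2 ≤ S₀ ^ 2 := Nat.pow_le_pow_left hS₀d 2
        have := Nat.log_pos one_lt_two (show 2 ≤ n by omega)
        omega))
  have h8 : 8 * 2 ^ ((Nat.log 2 n + c) ^ c) ≤ (2 ^ ((Nat.log 2 n + c) ^ c)) ^ 4 := by
    have : 2 ^ 3 ≤ (2 ^ ((Nat.log 2 n + c) ^ c)) ^ 3 := Nat.pow_le_pow_left hT2 3
    calc 8 * 2 ^ ((Nat.log 2 n + c) ^ c) = 2 ^ 3 * 2 ^ ((Nat.log 2 n + c) ^ c) := by norm_num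
      _ ≤ (2 ^ ((Nat.log 2 n + c) ^ c)) ^ 3 * 2 ^ ((Nat.log 2 n + c) ^ c) := Nat.mul_le_mul_right _ this
      _ = (2 ^ ((Nat.log 2 n + c) ^ c)) ^ 4 := by ring
  omega

/-- ★★★ **EXPONENTIAL RATE: `2^{κ√n}` MONOTONE GATES FOR `NN_n · hh` WHENEVER `Newt(hh)` HAS AT MOST `2^{κ√n}` GENERATORS (PROVED,
unconditional).**  There is `κ > 0` such that, eventually in `n`, every cofactor `hh ≠ 0` over `ℝ≥0` whose Newton polytope is the hull
of at most `2^{κ·√n}` points `q₀ j` (e.g. its vertices) has `2^{κ·√n} ≤ L₊(NN_n · hh)` — any degrees, any number of monomials.  (The exponential-rate form wanted by the sibling crux `NNNotVP`'s stub B2 ≡ exponential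
division hardness; it contains the quasi-polynomial form below.) [cite: HrubesYehudayoff2021, §6 Problem 2]
[cite: FioriniEtAl2015, Thm. 7] [cite: KaibelWeltge2014, Thm. 1] -/
theorem nn_complexity_expLowerBound_fewGenerators : ∃ κ : ℝ, 0 < κ ∧ ∃ n₀ : ℕ, ∀ n ≥ n₀,
    ∀ hh : MvPolynomial (Fin (2 * n) × Fin (2 * n)) ℝ≥0, hh ≠ 0 →
      ∀ {J : Type} [Fintype J] [Nonempty J] (q₀ : J → (Fin (2 * n) × Fin (2 * n)) → ℝ),
        newtonPolytope (MvPolynomial.map NNReal.toRealHom hh) = convexHull ℝ (Set.range q₀) →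
        (Fintype.card J : ℝ) ≤ (2 : ℝ) ^ (κ * Real.sqrt n) →
          (2 : ℝ) ^ (κ * Real.sqrt n) ≤ (complexity (nestFreeMatchingPoly n ℝ≥0 * hh) : ℝ) := by
  obtain ⟨cA, hcA, t₀, hexp⟩ := nn_passenger_three_pow_le_card
  set cm : ℝ := min cA 1 with hcm
  have hcm0 : 0 < cm := lt_min hcA one_pos
  have hcmA : cm ≤ cA := min_le_left _ _
  have hcm1 : cm ≤ 1 := min_le_right _ _
  obtain ⟨S₁, hS₁⟩ := exists_nat_ge ((20 / cm) ^ 2)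
  obtain ⟨S₀, hS₀a, hS₀c, hS₀d⟩ : ∃ S₀ : ℕ, 4 * t₀ + 4 ≤ S₀ ∧ S₁ ≤ S₀ ∧ 16 ≤ S₀ :=
    ⟨4 * t₀ + 4 + S₁ + 16, by omega, by omega, by omega⟩
  refine ⟨cm / 64, by positivity, S₀ ^ 2, fun n hn hh hh0 J _ _ q₀ hQ hcard => ?_⟩
  obtain ⟨s, hs⟩ : ∃ s, s = Nat.sqrt n := ⟨_, rfl⟩
  have hsS : S₀ ≤ s := by rw [hs]; exact Nat.le_sqrt'.2 hn
  have hss : s ^ 2 ≤ n := by rw [hs]; exact Nat.sqrt_le' n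
  have hns : n < (s + 1) ^ 2 := by rw [hs]; exact Nat.lt_succ_sqrt' n
  obtain ⟨g, hg⟩ : ∃ g, g = s / 4 := ⟨_, rfl⟩
  have h4g : 4 * g ≤ s := by rw [hg]; exact Nat.mul_div_le s 4
  have hg4 : s < 4 * (g + 1) := by rw [hg]; omega
  have hg1 : 1 ≤ g := by omega
  have hgt : t₀ ≤ g := by omega
  have hn' : (2 * g + 1) * (2 * (2 * g) + 1) ≤ n := by nlinarith [Nat.mul_le_mul h4g h4g]
  set L : ℕ := complexity (nestFreeMatchingPoly n ℝ≥0 * hh) with hL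
  have hEF : HasEFOfSize (newtonPolytope (MvPolynomial.map NNReal.toRealHom (nestFreeMatchingPoly n ℝ≥0)) +
      convexHull ℝ (Set.range q₀)) (3 * L) := by
    have h1 := hasEFOfSize_newtonPolytope_complexity (nestFreeMatchingPoly n ℝ≥0 * hh)
    rw [map_mul, newtonPolytope_mul, hQ] at h1
    exact h1
  obtain ⟨h, hch, hA⟩ := hexp n (2 * g) g (by omega) hn' (le_refl _) hgt q₀ (3 * L) hEF
  set x : ℝ := cm / 64 * Real.sqrt n with hx
  have hg_real : (s : ℝ) / 4 - 1 ≤ g := by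
    have : (s : ℝ) < 4 * ((g : ℝ) + 1) := by exact_mod_cast hg4
    linarith
  have h1 : cm * ((s : ℝ) / 4 - 1) ≤ h :=
    calc cm * ((s : ℝ) / 4 - 1) ≤ cm * g := mul_le_mul_of_nonneg_left hg_real hcm0.le
      _ ≤ cA * g := mul_le_mul_of_nonneg_right hcmA (Nat.cast_nonneg g)
      _ ≤ h := hch
  have hsqn : Real.sqrt n ≤ (s : ℝ) + 1 := by
    calc Real.sqrt n ≤ Real.sqrt (((s : ℝ) + 1) ^ 2) :=
          Real.sqrt_le_sqrt (by exact_mod_cast hns.le)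
      _ = (s : ℝ) + 1 := Real.sqrt_sq (by positivity)
  have hs16 : (16 : ℝ) ≤ s := by exact_mod_cast (show 16 ≤ s by omega)
  have hx8 : 8 * x ≤ h := by
    have e1 : cm / 64 * Real.sqrt n ≤ cm / 64 * ((s : ℝ) + 1) :=
      mul_le_mul_of_nonneg_left hsqn (by positivity)
    rw [hx]
    nlinarith
  have hx1 : 1 ≤ x := by
    have hS₁s : ((20 / cm) ^ 2 : ℝ) ≤ s := le_trans hS₁ (by exact_mod_cast (show S₁ ≤ s by omega))
    have hsn : (s : ℝ) ≤ Real.sqrt n := by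
      calc (s : ℝ) = Real.sqrt ((s : ℝ) ^ 2) := (Real.sqrt_sq (by positivity)).symm
        _ ≤ Real.sqrt n := Real.sqrt_le_sqrt (by exact_mod_cast hss)
    have h64 : 64 / cm ≤ (20 / cm) ^ 2 := by
      rw [div_pow, div_le_div_iff₀ hcm0 (by positivity)]
      nlinarith
    have : 64 / cm ≤ Real.sqrt n := h64.trans (hS₁s.trans hsn)
    rw [hx]
    have := mul_le_mul_of_nonneg_left this (show (0 : ℝ) ≤ cm / 64 by positivity)
    rwa [show cm / 64 * (64 / cm) = 1 by field_simp] at this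
  have hAR : ((3 : ℝ) / 2) ^ h ≤ (Fintype.card J : ℝ) * (3 * (L : ℝ) + 1) := by
    have : ((3 ^ h : ℕ) : ℝ) ≤ ((Fintype.card J * (3 * L + 1) * 2 ^ h : ℕ) : ℝ) := by exact_mod_cast hA
    push_cast at this
    rw [div_pow, div_le_iff₀ (by positivity)]
    linarith
  have hhalf : (2 : ℝ) ^ ((1 / 2 : ℝ) * (h : ℝ)) ≤ ((3 : ℝ) / 2) ^ h := by
    rw [Real.rpow_mul (by norm_num), Real.rpow_natCast]
    refine pow_le_pow_left₀ (by positivity) ?_ _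
    rw [← Real.sqrt_eq_rpow]
    calc Real.sqrt 2 ≤ Real.sqrt (((3 : ℝ) / 2) ^ 2) := Real.sqrt_le_sqrt (by norm_num)
      _ = 3 / 2 := Real.sqrt_sq (by norm_num)
  have h4x : (2 : ℝ) ^ (4 * x) ≤ (2 : ℝ) ^ ((1 / 2 : ℝ) * (h : ℝ)) :=
    Real.rpow_le_rpow_of_exponent_le (by norm_num) (by linarith)
  have hsplit : (2 : ℝ) ^ (4 * x) = (2 : ℝ) ^ x * (2 : ℝ) ^ (3 * x) := by
    rw [← Real.rpow_add (by norm_num)]; ring_nf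
  have h2x : (0 : ℝ) < (2 : ℝ) ^ x := by positivity
  have h3x : (2 : ℝ) ^ (3 * x) ≤ 3 * (L : ℝ) + 1 := by
    have hchain : (2 : ℝ) ^ x * (2 : ℝ) ^ (3 * x) ≤ (2 : ℝ) ^ x * (3 * (L : ℝ) + 1) := by
      calc (2 : ℝ) ^ x * (2 : ℝ) ^ (3 * x) = (2 : ℝ) ^ (4 * x) := hsplit.symm
        _ ≤ ((3 : ℝ) / 2) ^ h := h4x.trans hhalf
        _ ≤ (Fintype.card J : ℝ) * (3 * (L : ℝ) + 1) := hAR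
        _ ≤ (2 : ℝ) ^ x * (3 * (L : ℝ) + 1) := mul_le_mul_of_nonneg_right hcard (by positivity)
    exact le_of_mul_le_mul_left hchain h2x
  set y : ℝ := (2 : ℝ) ^ x with hy
  have hy2 : 2 ≤ y := by
    calc (2 : ℝ) = (2 : ℝ) ^ (1 : ℝ) := (Real.rpow_one 2).symm
      _ ≤ (2 : ℝ) ^ x := Real.rpow_le_rpow_of_exponent_le (by norm_num) hx1
  have hy3 : y ^ 3 ≤ 3 * (L : ℝ) + 1 := by
    have : (2 : ℝ) ^ (3 * x) = y ^ 3 := by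
      rw [hy, ← Real.rpow_natCast, ← Real.rpow_mul (by norm_num)]; ring_nf
    rw [← this]; exact h3x
  by_contra hlt
  push Not at hlt
  nlinarith [hy2, hy3, hlt, mul_le_mul_of_nonneg_left hy2 (by linarith : (0 : ℝ) ≤ y)]

/-- the monomials of `hh ≠ 0` generate its Newton polytope: `Newt(hh) = conv{realOf d : d ∈ supp hh}`, a family indexed by the
(nonempty, finite) support. [folklore] -/
theorem newtonPolytope_eq_convexHull_range_support {n : ℕ} (hh : MvPolynomial (Fin (2 * n) × Fin (2 * n)) ℝ≥0) :
    newtonPolytope (MvPolynomial.map NNReal.toRealHom hh) =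
      convexHull ℝ (Set.range fun d : hh.support => realOf (σ := Fin (2 * n) × Fin (2 * n)) d.1) := by
  have hS : suppPts hh = Set.range fun d : hh.support => realOf (σ := Fin (2 * n) × Fin (2 * n)) d.1 := by
    unfold suppPts; rw [Set.image_eq_range]; rfl
  rw [← newt_eq_newtonPolytope]; unfold newt; rw [hS]

/-- ★★★ **`NNDivisionHard` ON THE COFACTORS WITH AT MOST `2^{κ√n}` MONOMIALS (PROVED, unconditional):** `∃ κ > 0, ∀ c`, eventually
in `n`, every `hh ≠ 0` over `ℝ≥0` with `|supp hh| ≤ 2^{κ·√n}` satisfies `2^((log₂ n + c)^c) < L₊(NN_n · hh) + L₊(hh)` — any degrees,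
any Newton dimension. [cite: HrubesYehudayoff2021, §6 Problem 2] [cite: KaibelWeltge2014, Thm. 1] -/
theorem nnDivisionHard_fewMonomialsExp : ∃ κ : ℝ, 0 < κ ∧ ∀ c : ℕ, ∃ n₀ : ℕ, ∀ n ≥ n₀,
    ∀ hh : MvPolynomial (Fin (2 * n) × Fin (2 * n)) ℝ≥0, hh ≠ 0 →
      (hh.support.card : ℝ) ≤ (2 : ℝ) ^ (κ * Real.sqrt n) →
        2 ^ ((Nat.log 2 n + c) ^ c) < complexity (nestFreeMatchingPoly n ℝ≥0 * hh) + complexity hh := by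
  obtain ⟨κ, hκ, H⟩ := nnDivisionHard_fewGeneratorsExp
  refine ⟨κ, hκ, fun c => ?_⟩
  obtain ⟨n₀, hn₀⟩ := H c
  refine ⟨n₀, fun n hn hh hh0 hcard => ?_⟩
  haveI : Nonempty hh.support := (MvPolynomial.support_nonempty.2 hh0).coe_sort
  refine hn₀ n hn hh hh0 (fun d : hh.support => realOf (σ := Fin (2 * n) × Fin (2 * n)) d.1)
    (newtonPolytope_eq_convexHull_range_support hh) ?_
  rwa [Fintype.card_coe]

/-- ★★★ **EXPONENTIAL RATE, MONOMIAL COUNT:** `∃ κ > 0`, eventually in `n`, every `hh ≠ 0` over `ℝ≥0` with `|supp hh| ≤ 2^{κ·√n}`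
has `2^{κ·√n} ≤ L₊(NN_n · hh)` — any degrees. [cite: HrubesYehudayoff2021, §6 Problem 2] [cite: KaibelWeltge2014, Thm. 1] -/
theorem nn_complexity_expLowerBound_fewMonomials : ∃ κ : ℝ, 0 < κ ∧ ∃ n₀ : ℕ, ∀ n ≥ n₀,
    ∀ hh : MvPolynomial (Fin (2 * n) × Fin (2 * n)) ℝ≥0, hh ≠ 0 →
      (hh.support.card : ℝ) ≤ (2 : ℝ) ^ (κ * Real.sqrt n) →
        (2 : ℝ) ^ (κ * Real.sqrt n) ≤ (complexity (nestFreeMatchingPoly n ℝ≥0 * hh) : ℝ) := by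
  obtain ⟨κ, hκ, n₀, hn₀⟩ := nn_complexity_expLowerBound_fewGenerators
  refine ⟨κ, hκ, n₀, fun n hn hh hh0 hcard => ?_⟩
  haveI : Nonempty hh.support := (MvPolynomial.support_nonempty.2 hh0).coe_sort
  refine hn₀ n hn hh hh0 (fun d : hh.support => realOf (σ := Fin (2 * n) × Fin (2 * n)) d.1)
    (newtonPolytope_eq_convexHull_range_support hh) ?_
  rwa [Fintype.card_coe]

end RouteRate

end FewGenerators

end Summit.ValiantsHypothesis.ValiantsHypothesis.Theorems.FifoMatching

end
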